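import Literature.ComputerArithmetic.FloatingPoint.MiniFloat

/-!
# Double rounding of products at equal quanta, any register precision: the coarse window as a table

HONEST FRAMING (venture CertifiedArithmetic / cell `pub-lowprec`): certified error envelopes and
provably optimal rounding/accumulation schemes for low-precision formats under stated cost models;
every table by two implementations; no hardware or vendor claims.

The integer side (implementation B) of the decision of `DRMul` at equal quanta for EVERY register
precision `P_ψ > P` (`DoubleRoundingProductSameQuantumStripLaw.lean`), completing the `d = 0` line
(`DoubleRoundingProductSameQuantumLaw.lean` needed `P_ψ ≥ 2P`).  Setting: target `φ` (`m = m_φ`,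
`P = m + 1`), register `ψ` with the SAME quantum `q` and `m_ψ = m + δ`, `δ ≥ 1`.  A product of
`φ`-data is `K·2^E·q`, `K = oa·ob` the product of the odd parts, `K = c·2^t + r` with
`2^m ≤ c < 2^(m+1)` (`t ≤ P` extra bits, `r < 2^t`); in the binade where `φ` has spacing
`2^(k+1) q` the register holds every multiple of `2^e q`, `e = k + 1 - δ` (truncated: `e = 0` is the
zone where `ψ` holds every multiple of `q`).  With `2^g = ` half that spacing in units of the last
bit of `K` (`e + t = k + 2 + g`; no `g` means the product is a value of `ψ`), a slip forces THE
COARSE WINDOW (`DoubleRoundingProductSameQuantumCoarse.lean`): `|r - 2^(t-1)| ≤ 2^g` on the odd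
side of the midpoint (`c` even above, `c` odd below), the boundary (a tie of `ψ`) included iff
`e + 1 ≤ k`.  By scale invariance only `k < δ` (`e = 0`, `g = t - 2 - k`, tie iff `k ≥ 1`) and ONE
representative of `k + 1 ≥ δ` (`g = t - 1 - δ`, tie iff `δ ≥ 2`) matter: the test
`mulStripHitAt P δ t oa ob` and the table `mulStripHit P δ` (§1).  NO hit for `P ≤ 3` at any `δ`
(the kernel, `mulStripHit_table`; `δ ≥ P` behaves as `δ = P`), hits for `4 ≤ P ≤ 6` at every `δ`
(implementation A: `7, 36, 200` hit cells `(t, oa, ob)` for `P = 4, 5, 6`, the same number at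
every `δ`).
Two implementations: A = `code/enum/mul_sameq_strip_law.py` (literal transcription incl. truncated
subtraction; hit cells = slipping cells of the exact-rational odd-parts model, `P ≤ 7`; brute force
on pseudo-records) → `certs/enum/DOUBLE-ROUNDING-MUL-SAMEQ-STRIP.json`; B = this file.
PLACEMENT — KNOWN: slips happen only through midpoints of the target
([MartinDorelMelquiondMuller2013] Property 2.1; [BoldoMelquiond2008] Thm 3; [Figueroa1995] §2–3,
whose sufficient condition `P_ψ ≥ 2P` is not necessary for `P ≤ 3`).  NEW (modestly): the
decidable window at `d = 0` for every register precision.  No hardware or vendor claims.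
-/

namespace Summit.Ventures.CertifiedArithmetic

/-! ## §1 The coarse window in integers -/

/-- THE COARSE WINDOW TEST at one odd pair `(oa, ob)`: `K = oa·ob = c·2^t + r`, `c` a normal
significand of precision `P`, half-spacing `2^g` of the register (in units of the last bit of `K`),
`tie` = whether the boundary counts:
`(c even ∧ 2^(t-1) < r ∧ (r < 2^(t-1) + 2^g ∨ (tie ∧ r = 2^(t-1) + 2^g))) ∨
 (c odd ∧ r < 2^(t-1) ∧ (2^(t-1) < r + 2^g ∨ (tie ∧ r + 2^g = 2^(t-1))))`. [this packet] -/
def mulStripWinAt (P t g : ℕ) (tie : Bool) (oa ob : ℕ) : Bool :=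
  let K := oa * ob
  let c := K / 2 ^ t
  let r := K % 2 ^ t
  decide (2 ^ (P - 1) ≤ c) && decide (c < 2 ^ P) &&
    ((c % 2 == 0 && decide (2 ^ (t - 1) < r) &&
        (decide (r < 2 ^ (t - 1) + 2 ^ g) || (tie && r == 2 ^ (t - 1) + 2 ^ g))) ||
      (c % 2 == 1 && decide (r < 2 ^ (t - 1)) &&
        (decide (2 ^ (t - 1) < r + 2 ^ g) || (tie && r + 2 ^ g == 2 ^ (t - 1)))))

/-- THE HIT TEST at register gap `δ = m_ψ - m_φ ≥ 1` and `t` extra bits: the scale-free zone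
`k + 1 ≥ δ` (`g = t - 1 - δ`, needs `δ + 1 ≤ t`, tie iff `δ ≥ 2`) or some binade `k < δ` of the
zone where `ψ` holds every multiple of `q` (`g = t - 2 - k`, needs `k + 2 ≤ t`, tie iff `k ≥ 1`).
[this packet] -/
def mulStripHitAt (P δ t oa ob : ℕ) : Bool :=
  (decide (δ + 1 ≤ t) && mulStripWinAt P t (t - 1 - δ) (decide (2 ≤ δ)) oa ob) ||
    (List.range (min δ (P - 1))).any fun k =>
      decide (k + 2 ≤ t) && mulStripWinAt P t (t - 2 - k) (decide (1 ≤ k)) oa ob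

/-- `hit(P, δ)`: some `1 ≤ t ≤ P` and odd `oa, ob < 2^P` pass the hit test. [this packet] -/
def mulStripHit (P δ : ℕ) : Bool :=
  (List.range P).any fun i =>
    (List.range (2 ^ (P - 1))).any fun j =>
      (List.range (2 ^ (P - 1))).any fun l => mulStripHitAt P δ (i + 1) (2 * j + 1) (2 * l + 1)

set_option maxHeartbeats 4000000 in
/-- Implementation B of the table for `2 ≤ P ≤ 6`, `1 ≤ δ ≤ P + 1` (kernel): NO hit for `P ≤ 3`,
a hit at every `δ` for `4 ≤ P ≤ 6` (implementation A: `0, 0, 7, 36, 200` hit cells `(t, oa, ob)`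
for `P = 2, …, 6`, at every `δ`). [this packet] -/
theorem mulStripHit_table :
    [2, 3, 4, 5, 6].map (fun P => (List.range (P + 1)).map fun i => mulStripHit P (i + 1))
      = [[false, false, false], [false, false, false, false], [true, true, true, true, true],
          [true, true, true, true, true, true], [true, true, true, true, true, true, true]] := by
  decide +kernel

/-- NO HIT FOR `P ≤ 3`, every `1 ≤ δ ≤ P` (`δ` clamped at `P` is the form the law consumes; at
`δ = 0` the table is void: the midpoints of `φ` are not values of `ψ`). [this packet] -/
theorem mulStripHit_eq_false_of_le_three {P δ : ℕ} (hP : P ≤ 3) (hδ1 : 1 ≤ δ) (hδ : δ ≤ P) :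
    mulStripHit P δ = false := by
  have h : ∀ Q < 4, ∀ d < 4, 1 ≤ d → mulStripHit Q d = false := by decide +kernel
  exact h P (by omega) δ (by omega) hδ1

/-! ## §2 From the window disjunction to a hit -/

/-- The window disjunction at `K = c·2^t + r`, `2^(P-1) ≤ c < 2^P`, with the tie flag a decidable
proposition `T`, is a hit of `mulStripWinAt P t g (decide T) oa ob`. [this packet] -/
theorem mulStripWinAt_of_window {P t g oa ob c r : ℕ} {T : Prop} [Decidable T]
    (hK : oa * ob = c * 2 ^ t + r) (hr : r < 2 ^ t) (hclo : 2 ^ (P - 1) ≤ c) (hchi : c < 2 ^ P)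
    (hw : (c % 2 = 0 ∧ 2 ^ (t - 1) < r ∧
        (r < 2 ^ (t - 1) + 2 ^ g ∨ (T ∧ r = 2 ^ (t - 1) + 2 ^ g))) ∨
      (c % 2 = 1 ∧ r < 2 ^ (t - 1) ∧
        (2 ^ (t - 1) < r + 2 ^ g ∨ (T ∧ r + 2 ^ g = 2 ^ (t - 1))))) :
    mulStripWinAt P t g (decide T) oa ob = true := by
  obtain ⟨hc, hr'⟩ := (Nat.div_mod_unique (a := oa * ob) (b := 2 ^ t) (c := r) (d := c)
    (by positivity)).mpr ⟨by rw [hK]; ring, hr⟩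
  simp only [mulStripWinAt]
  rw [hc, hr']
  by_cases hT : T
  · simp only [hT, true_and, decide_true, Bool.or_eq_true, Bool.and_eq_true, beq_iff_eq,
      decide_eq_true_eq] at hw ⊢
    omega
  · simp only [hT, false_and, or_false, decide_false, Bool.false_and, Bool.or_false,
      Bool.or_eq_true, Bool.and_eq_true, beq_iff_eq, decide_eq_true_eq] at hw ⊢
    omega

/-- A hit in the scale-free zone (`δ + 1 ≤ t ≤ P`, odd `oa, ob < 2^P`) is a hit of
`mulStripHit P δ`. [this packet] -/
theorem mulStripHit_of_winAt_far {P δ t oa ob : ℕ} (hδt : δ + 1 ≤ t) (htP : t ≤ P)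
    (hoa : oa % 2 = 1) (hoa' : oa < 2 ^ P) (hob : ob % 2 = 1) (hob' : ob < 2 ^ P)
    (h : mulStripWinAt P t (t - 1 - δ) (decide (2 ≤ δ)) oa ob = true) :
    mulStripHit P δ = true := by
  have hP : 2 ^ P = 2 * 2 ^ (P - 1) := by
    rcases P with _ | P
    · simp at hoa'; omega
    · rw [pow_succ']; rfl
  unfold mulStripHit
  simp only [List.any_eq_true, List.mem_range]
  refine ⟨t - 1, by omega, oa / 2, by omega, ob / 2, by omega, ?_⟩
  rw [Nat.sub_add_cancel (by omega), show 2 * (oa / 2) + 1 = oa by omega,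
    show 2 * (ob / 2) + 1 = ob by omega]
  unfold mulStripHitAt
  simp only [Bool.or_eq_true, Bool.and_eq_true, decide_eq_true_eq]
  exact Or.inl ⟨hδt, h⟩

/-- A hit in a binade `k < min δ (P-1)` of the fine-register zone (`k + 2 ≤ t ≤ P`, odd
`oa, ob < 2^P`) is a hit of `mulStripHit P δ`. [this packet] -/
theorem mulStripHit_of_winAt_near {P δ t k oa ob : ℕ} (hk : k < min δ (P - 1)) (hkt : k + 2 ≤ t)
    (htP : t ≤ P) (hoa : oa % 2 = 1) (hoa' : oa < 2 ^ P) (hob : ob % 2 = 1) (hob' : ob < 2 ^ P)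
    (h : mulStripWinAt P t (t - 2 - k) (decide (1 ≤ k)) oa ob = true) :
    mulStripHit P δ = true := by
  have hP : 2 ^ P = 2 * 2 ^ (P - 1) := by
    rcases P with _ | P
    · simp at hoa'; omega
    · rw [pow_succ']; rfl
  unfold mulStripHit
  simp only [List.any_eq_true, List.mem_range]
  refine ⟨t - 1, by omega, oa / 2, by omega, ob / 2, by omega, ?_⟩
  rw [Nat.sub_add_cancel (by omega), show 2 * (oa / 2) + 1 = oa by omega,
    show 2 * (ob / 2) + 1 = ob by omega]
  unfold mulStripHitAt
  simp only [Bool.or_eq_true, Bool.and_eq_true, decide_eq_true_eq, List.any_eq_true,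
    List.mem_range]
  exact Or.inr ⟨k, hk, hkt, h⟩

end Summit.Ventures.CertifiedArithmetic
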